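import Mathlib.Topology.Instances.ZMod
import Mathlib.NumberTheory.Padics.RingHoms
import Mathlib.FieldTheory.Finite.Basic
import Literature.AnabelianGeometry.AbsoluteAnabelian.AbsAnabFundamentalGroups
import HarnessLib

/-!
# [AbsAnab] §1.3 (Lemmas 1.3.8, 1.3.9; p. 19 "`q₁ = q₂`"): the three SCHEMA rows settled
# (FACT-LIST F-0006 `PreservesCuspidalInertia`, F-0007 `PreservesGeom`, F-0009 `SameResidueCard`)

S. Mochizuki, *The Absolute Anabelian Geometry of Hyperbolic Curves* (2004) [AbsAnab], §1.3
pp. 18–19 (manuscript pagination, lit key `paper:url-e8f118cc205e`).  abc-iut-L4-t4's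
`AbsAnabFundamentalGroups.lean` types Lemma 1.3.8 ("`α` is compatible with the quotients
`Π ↠ G_{Kᵢ}`"), the p. 19 sentence "Lemma 1.3.8, Proposition 1.2.1, (v), imply that `q₁ = q₂`", and
Lemma 1.3.9, second sentence ("`α` maps inertia groups of cusps to inertia groups of cusps") as
PREDICATES on abstract data — `PreservesGeom α`, `SameResidueCard B₁ B₂`,
`PreservesCuspidalInertia C D α` — which "assert nothing by themselves" (module docstring of the
statement file): the printed lemmas are about fundamental groups of hyperbolic curves over MLF's,
and the tree binds the predicates only behind that antecedent.  The FACT-LIST lists the three as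
PARAMETRISED rows (kernel_closedness = parametrised); this PROOF-ONLY file (no `def`, no
`instance`; countermodels are built inside the proofs) records the kernel facts that settle them:

* **universal closures REFUTED** by explicit models —
  `not_forall_preservesGeom` (`Π = ℤ/2` profinite; `E`: `aug = id`, `Δ = 1`; `F`: `G = 1`,
  `Δ = Π`; `α = id` does not carry `Δ_E` onto `Δ_F`);
  `not_forall_sameResidueCard` (GENUINE MLF bases: the point extensions `Π = G = G_{ℚ₂}` resp.
  `G_{ℚ₃}`; the prime-to-`p` roots of unity number `1` in `ℚ₂` — `padicTwo_eq_one_of_pow_eq_one`: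
  an odd-order root of unity of `ℚ₂` is `1`, via `ℤ₂ → ℤ/2^{k+1}` and `|(ℤ/2^{k+1})ˣ| = 2^k` — but
  at least `2` (`±1`) in `ℚ₃`);
  `not_forall_preservesCuspidalInertia` (one cusp on the source, none on the target);
* **instance forms** of F-0006: `preservesCuspidalInertia_refl`, `PreservesCuspidalInertia.trans`,
  `preservesCuspidalInertia_of_isEmpty` (model witnesses), and the bookkeeping step of the printed
  proof `PreservesGeom.preservesCuspidalInertia_of_decomp`: an `α` carrying `Δ₁` onto `Δ₂` and
  cuspidal decomposition groups onto cuspidal decomposition groups (up to conjugacy) carries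
  inertia groups of cusps onto inertia groups of cusps (`I = D ∩ Δ`); and conversely
  `PreservesCuspidalInertia.preservesDecomp_of_decompEqNormalizer` (`D = N_Π(I)`, the tree's
  `CuspidalData.DecompEqNormalizer`): inertia form ⟹ decomposition form;
* the instance forms of F-0007 and F-0009 behind their PRINTED antecedents are ALREADY theorems
  of the tree and are only cited here: `preservesGeom_of_starCondition` /
  `preservesGeom_of_coinvariantRankConstant` (`AbsTopIThm26vHolds.lean`: every `Π₁ ⥲ Π₂`
  between extensions with MLF base data satisfying the printed hypotheses of Lemma 1.1.4 (ii)
  preserves `Δ` — print: Lemma 1.3.8 "follows formally from Lemmas 1.1.4, 1.1.5") and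
  `sameResidueCard_of_preservesGeom'` (`MLFGaloisGroupsHolds.lean`: `q₁ = q₂` from
  `PreservesGeom α`, with NO named input).

HONEST FRAMING: consistency / vacuity facts about the cell's own typing of refereed lemmas; a
FACT-LIST row is an assumption label, not an endorsement; nothing here bears on [IUTchIII]
Cor. 3.12; typed ≠ proved.
-/

noncomputable section

open Topology
open scoped Pointwise

namespace Literature.AnabelianGeometry.AbsoluteAnabelian

open Field

namespace FundamentalExtension

/-! ### F-0007 `PreservesGeom`: the universal closure is false -/

/-- **F-0007, universal closure REFUTED.**  "`α` carries `Δ₁` onto `Δ₂`" is a genuine condition on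
`α`: with `Π := ℤ/2` (a finite, hence profinite, group), `E := (Π ↠ Π, aug = id)` has `Δ_E = 1`
while `F := (Π ↠ 1)` has `Δ_F = Π`, and `α := id : Π ⥲ Π` maps `Δ_E = 1` to `1 ≠ Δ_F`.
[cite: MochizukiAbsAnab2004, Lemma 1.3.8 p.18] -/
theorem not_forall_preservesGeom :
    ¬ ∀ (E F : FundamentalExtension.{0}) (α : E.arith ≃ₜ* F.arith), PreservesGeom α := by
  intro h
  let P : ProfiniteGrp.{0} := ProfiniteGrp.of (Multiplicative (ZMod 2))
  let T : ProfiniteGrp.{0} := ProfiniteGrp.of (Multiplicative (ZMod 1))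
  let E : FundamentalExtension.{0} :=
    { arith := P, gal := P, aug := ContinuousMonoidHom.id P
      aug_surjective := Function.surjective_id }
  let F : FundamentalExtension.{0} :=
    { arith := P, gal := T, aug := 1, aug_surjective := fun _ => ⟨1, Subsingleton.elim _ _⟩ }
  have hα : E.geom.map (ContinuousMulEquiv.refl P).toMulEquiv.toMonoidHom = F.geom :=
    h E F (ContinuousMulEquiv.refl P)
  -- the non-trivial element of `Π` lies in `Δ_F = Π` …
  obtain ⟨x, hxF, hx1⟩ : ∃ x : F.arith, x ∈ F.geom ∧ x ≠ 1 :=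
    ⟨Multiplicative.ofAdd (1 : ZMod 2), rfl,
      Multiplicative.ofAdd.injective.ne (show (1 : ZMod 2) ≠ 0 by decide)⟩
  -- … but not in `α(Δ_E) = α(1) = 1`
  rw [← hα, Subgroup.mem_map] at hxF
  obtain ⟨y, hy, rfl⟩ := hxF
  rw [mem_geom] at hy
  change y = 1 at hy
  subst hy
  exact hx1 (map_one _)

/-! ### F-0009 `SameResidueCard`: the universal closure is false -/

/-- The arithmetic input of the countermodel: **an odd-order root of unity of `ℚ₂` is trivial.**
(`ζⁿ = 1`, `n` odd ⟹ `|ζ| = 1`, so `ζ ∈ ℤ₂`; its image in each `(ℤ/2^{k+1})ˣ`, a group of order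
`2^k`, has order dividing `gcd(n, 2^k) = 1`; and `ℤ₂ → lim ℤ/2^k` is injective.)  Hence the only
root of unity of `ℚ₂` of order prime to `2` is `1` ("`q − 1 = 1`" for `K = ℚ₂`). [folklore] -/
private theorem padicTwo_eq_one_of_pow_eq_one (ζ : ℚ_[2]) {n : ℕ} (hn : ¬ 2 ∣ n) (hζ : ζ ^ n = 1) :
    ζ = 1 := by
  have hn0 : n ≠ 0 := by
    rintro rfl
    exact hn (dvd_zero 2)
  have hnorm : ‖ζ‖ = 1 := by
    have h := congrArg norm hζ
    rw [norm_pow, norm_one] at h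
    exact (pow_eq_one_iff_of_nonneg (norm_nonneg ζ) hn0).mp h
  -- pass to `ℤ₂`
  set z : ℤ_[2] := ⟨ζ, hnorm.le⟩ with hzdef
  have hz : z ^ n = 1 := Subtype.ext (by simp [hzdef, hζ])
  have hcop : ∀ k : ℕ, n.gcd (2 ^ k) = 1 := fun k =>
    Nat.Coprime.pow_right k ((Nat.Prime.coprime_iff_not_dvd Nat.prime_two).mpr hn).symm
  have key : ∀ k : ℕ, PadicInt.toZModPow k z = 1 := by
    intro k
    cases k with
    | zero =>
      haveI : Subsingleton (ZMod (2 ^ 0)) := ZMod.subsingleton_iff.mpr (pow_zero 2)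
      exact Subsingleton.elim _ _
    | succ k =>
      let u : (ZMod (2 ^ (k + 1)))ˣ :=
        Units.map (PadicInt.toZModPow (k + 1) : ℤ_[2] →+* ZMod (2 ^ (k + 1))).toMonoidHom
          (Units.ofPowEqOne z n hz hn0)
      have hu1 : u ^ n = 1 := by
        rw [← map_pow, Units.pow_ofPowEqOne, map_one]
      have hφ : Nat.totient (2 ^ (k + 1)) = 2 ^ k := by
        rw [Nat.totient_prime_pow_succ Nat.prime_two]
        norm_num
      have hu2 : u ^ 2 ^ k = 1 := by
        have := ZMod.pow_totient u
        rwa [hφ] at this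
      have hu3 : u = 1 := by
        have := pow_gcd_eq_one.mpr ⟨hu1, hu2⟩
        rwa [hcop k, pow_one] at this
      have hval := congrArg Units.val hu3
      simpa [u] using hval
  have hz1 : z = 1 := PadicInt.ext_of_toZModPow.mp fun k => by rw [key k, map_one]
  have := congrArg (fun w : ℤ_[2] => (w : ℚ_[2])) hz1
  simpa [hzdef] using this

/-- **F-0009, universal closure REFUTED, with GENUINE MLF bases.**  For the point extensions
`Π = G = G_{ℚ₂}` (base `K₁ = ℚ₂`, `p₁ = 2`) and `Π = G = G_{ℚ₃}` (base `K₂ = ℚ₃`, `p₂ = 3`) the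
numbers of prime-to-`pᵢ` roots of unity differ: exactly `1` in `ℚ₂`
(`padicTwo_eq_one_of_pow_eq_one`), at least the two elements `±1` in `ℚ₃`.  So
`∀ E F B₁ B₂, SameResidueCard B₁ B₂` fails — as it must: the print deduces `q₁ = q₂` FROM an
isomorphism `Π₁ ⥲ Π₂` compatible with the quotients (Lemma 1.3.8), and that conditional form is
the tree's theorem `sameResidueCard_of_preservesGeom'`. [cite: MochizukiAbsAnab2004, §1.3 p.19] -/
theorem not_forall_sameResidueCard :
    ¬ ∀ (E F : FundamentalExtension.{0}) (B₁ : E.MLFBase) (B₂ : F.MLFBase),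
      SameResidueCard B₁ B₂ := by
  intro h
  let E : FundamentalExtension.{0} :=
    { arith := absoluteGaloisGrp ℚ_[2], gal := absoluteGaloisGrp ℚ_[2]
      aug := ContinuousMonoidHom.id _, aug_surjective := Function.surjective_id }
  let F : FundamentalExtension.{0} :=
    { arith := absoluteGaloisGrp ℚ_[3], gal := absoluteGaloisGrp ℚ_[3]
      aug := ContinuousMonoidHom.id _, aug_surjective := Function.surjective_id }
  let B₁ : E.MLFBase := { p := 2, K := ℚ_[2], galIso := ContinuousMulEquiv.refl _ }
  let B₂ : F.MLFBase := { p := 3, K := ℚ_[3], galIso := ContinuousMulEquiv.refl _ }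
  have hS : Nat.card {ζ : ℚ_[2] // ∃ n : ℕ, 0 < n ∧ ¬ 2 ∣ n ∧ ζ ^ n = 1} =
      Nat.card {ζ : ℚ_[3] // ∃ n : ℕ, 0 < n ∧ ¬ 3 ∣ n ∧ ζ ^ n = 1} :=
    h E F B₁ B₂
  -- left-hand side: exactly one such root of unity
  have h1 : Nat.card {ζ : ℚ_[2] // ∃ n : ℕ, 0 < n ∧ ¬ 2 ∣ n ∧ ζ ^ n = 1} = 1 := by
    rw [Nat.card_eq_one_iff_unique]
    refine ⟨⟨fun a b => Subtype.ext ?_⟩, ⟨⟨1, 1, one_pos, by decide, one_pow 1⟩⟩⟩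
    obtain ⟨n, -, hn, ha⟩ := a.2
    obtain ⟨m, -, hm, hb⟩ := b.2
    rw [padicTwo_eq_one_of_pow_eq_one a.1 hn ha, padicTwo_eq_one_of_pow_eq_one b.1 hm hb]
  -- right-hand side: `1 ≠ -1` are two of them
  have h2 : Nat.card {ζ : ℚ_[3] // ∃ n : ℕ, 0 < n ∧ ¬ 3 ∣ n ∧ ζ ^ n = 1} ≠ 1 := by
    rw [Ne, Nat.card_eq_one_iff_unique]
    rintro ⟨hsub, -⟩
    have h12 := congrArg Subtype.val
      (hsub.elim ⟨1, 2, two_pos, by decide, one_pow 2⟩ ⟨-1, 2, two_pos, by decide, neg_one_sq⟩)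
    have h20 : (2 : ℚ_[3]) = 0 := by
      change (1 : ℚ_[3]) = -1 at h12
      linear_combination h12
    exact two_ne_zero h20
  exact h2 (hS ▸ h1)

/-! ### F-0006 `PreservesCuspidalInertia`: closure false; instance forms -/

variable {E F K : FundamentalExtension.{0}}

/-- **F-0006, universal closure REFUTED.**  Cuspidal data with ONE cusp on the source and NONE on
the target: no isomorphism can "map inertia groups of cusps to inertia groups of cusps" (there is
no cusp `y` to map to).  Model: the point extension on `Π = ℤ/2`, `D_x := Π`, `α := id`.
[cite: MochizukiAbsAnab2004, Lemma 1.3.9 p.19] -/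
theorem not_forall_preservesCuspidalInertia :
    ¬ ∀ (E F : FundamentalExtension.{0}) (C : CuspidalData E) (D : CuspidalData F)
      (α : E.arith ≃ₜ* F.arith), PreservesCuspidalInertia C D α := by
  intro h
  let P : ProfiniteGrp.{0} := ProfiniteGrp.of (Multiplicative (ZMod 2))
  let E : FundamentalExtension.{0} :=
    { arith := P, gal := P, aug := ContinuousMonoidHom.id P
      aug_surjective := Function.surjective_id }
  let C : CuspidalData E :=
    { Cusp := PUnit.{1}
      Dcusp := fun _ => ⊤
      Icusp := fun _ => ⊤ ⊓ E.geom
      Icusp_eq := fun _ => rfl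
      isClosed_Dcusp := fun _ => by
        rw [Subgroup.coe_top]
        exact isClosed_univ
      eq_of_conj := fun x y _ _ => Subsingleton.elim x y }
  let D : CuspidalData E :=
    { Cusp := PEmpty.{1}
      Dcusp := fun x => x.elim
      Icusp := fun x => x.elim
      Icusp_eq := fun x => x.elim
      isClosed_Dcusp := fun x => x.elim
      eq_of_conj := fun x => x.elim }
  obtain ⟨y, -, -⟩ := h E E C D (ContinuousMulEquiv.refl P) PUnit.unit 1
  exact y.elim

/-- Model witness: the identity maps inertia groups of cusps to inertia groups of cusps (same
cusp, same conjugating element). [cite: MochizukiAbsAnab2004, Lemma 1.3.9 p.19] -/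
theorem preservesCuspidalInertia_refl (C : CuspidalData E) :
    PreservesCuspidalInertia C C (ContinuousMulEquiv.refl E.arith) := by
  intro x g
  refine ⟨x, g, ?_⟩
  exact Subgroup.map_id _

/-- Model witness: cuspidal data without cusps (the proper case) are preserved by every `α`,
vacuously. [cite: MochizukiAbsAnab2004, Lemma 1.3.9 p.19] -/
theorem preservesCuspidalInertia_of_isEmpty (C : CuspidalData E) [IsEmpty C.Cusp]
    (D : CuspidalData F) (α : E.arith ≃ₜ* F.arith) : PreservesCuspidalInertia C D α :=
  fun x => isEmptyElim x

/-- Transitivity: if `α : Π_E ⥲ Π_F` and `β : Π_F ⥲ Π_K` map inertia groups of cusps to inertia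
groups of cusps, so does `β ∘ α`. [cite: MochizukiAbsAnab2004, Lemma 1.3.9 p.19] -/
theorem PreservesCuspidalInertia.trans {C : CuspidalData E} {D : CuspidalData F}
    {D' : CuspidalData K} {α : E.arith ≃ₜ* F.arith} {β : F.arith ≃ₜ* K.arith}
    (h₁ : PreservesCuspidalInertia C D α) (h₂ : PreservesCuspidalInertia D D' β) :
    PreservesCuspidalInertia C D' (α.trans β) := by
  intro x g
  obtain ⟨y, h, hy⟩ := h₁ x g
  obtain ⟨y', h', hy'⟩ := h₂ y h
  refine ⟨y', h', ?_⟩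
  rw [show (α.trans β).toMulEquiv.toMonoidHom =
      β.toMulEquiv.toMonoidHom.comp α.toMulEquiv.toMonoidHom from rfl,
    ← Subgroup.map_map, hy, hy']

/-- **The bookkeeping step of the proof of Lemma 1.3.9 (`I_x = D_x ∩ Δ`).**  If `α : Π₁ ⥲ Π₂`
carries `Δ₁` onto `Δ₂` (Lemma 1.3.8, `PreservesGeom α`) and carries every conjugate of a cuspidal
decomposition group `D_x` of `X₁` onto a conjugate of a cuspidal decomposition group `D_y` of
`X₂`, then it "maps inertia groups of cusps in `Δ_{X₁}` to inertia groups of cusps in `Δ_{X₂}`".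
[cite: MochizukiAbsAnab2004, Lemma 1.3.9 p.19] -/
theorem PreservesGeom.preservesCuspidalInertia_of_decomp {C : CuspidalData E} {D : CuspidalData F}
    {α : E.arith ≃ₜ* F.arith} (hα : PreservesGeom α)
    (hD : ∀ (x : C.Cusp) (g : E.arith), ∃ (y : D.Cusp) (h : F.arith),
      (MulAut.conj g • C.Dcusp x).map α.toMulEquiv.toMonoidHom = MulAut.conj h • D.Dcusp y) :
    PreservesCuspidalInertia C D α := by
  intro x g
  obtain ⟨y, h, hyh⟩ := hD x g
  refine ⟨y, h, ?_⟩
  have hinj : Function.Injective α.toMulEquiv.toMonoidHom := α.injective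
  rw [C.Icusp_eq, D.Icusp_eq, Subgroup.smul_inf, Subgroup.smul_inf,
    Subgroup.Normal.conj_smul_eq_self g E.geom, Subgroup.Normal.conj_smul_eq_self h F.geom,
    Subgroup.map_inf _ _ _ hinj, hyh]
  exact congrArg (MulAut.conj h • D.Dcusp y ⊓ ·) hα

/-- Conjugation commutes with taking normalizers. [folklore] -/
private theorem conj_smul_normalizer {G : Type*} [Group G] (g : G) (H : Subgroup G) :
    MulAut.conj g • Subgroup.normalizer (H : Set G) =
      Subgroup.normalizer ((MulAut.conj g • H : Subgroup G) : Set G) := by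
  rw [Subgroup.pointwise_smul_def, Subgroup.pointwise_smul_def]
  exact Subgroup.map_normalizer_eq_of_bijective H (MulAction.bijective (MulAut.conj g))

/-- **Converse bookkeeping (`D_x = N_Π(I_x)`, [AbsTopIII] Thm 1.11 (b) in the tree's
`CuspidalData.DecompEqNormalizer`).**  If `α` maps inertia groups of cusps to inertia groups of
cusps and, on both sides, the decomposition group of each cusp is the normalizer of its inertia
group, then `α` maps cuspidal decomposition groups to cuspidal decomposition groups (up to
conjugacy) — so, together with `PreservesGeom.preservesCuspidalInertia_of_decomp`, the inertia
form (Lemma 1.3.9) and the decomposition form of "`α` preserves cusps" are interchangeable behind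
`PreservesGeom` + `DecompEqNormalizer`. [cite: MochizukiAbsAnab2004, Lemma 1.3.9 p.19] -/
theorem PreservesCuspidalInertia.preservesDecomp_of_decompEqNormalizer {C : CuspidalData E}
    {D : CuspidalData F} {α : E.arith ≃ₜ* F.arith} (hα : PreservesCuspidalInertia C D α)
    (hC : C.DecompEqNormalizer) (hD : D.DecompEqNormalizer) :
    ∀ (x : C.Cusp) (g : E.arith), ∃ (y : D.Cusp) (h : F.arith),
      (MulAut.conj g • C.Dcusp x).map α.toMulEquiv.toMonoidHom = MulAut.conj h • D.Dcusp y := by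
  intro x g
  obtain ⟨y, k, hyk⟩ := hα x g
  refine ⟨y, k, ?_⟩
  rw [hC x, hD y, conj_smul_normalizer g, conj_smul_normalizer k,
    Subgroup.map_equiv_normalizer_eq, hyk]

end FundamentalExtension

end Literature.AnabelianGeometry.AbsoluteAnabelian

end
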